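import Summits.BirchSwinnertonDyer.BirchSwinnertonDyer.Theorems.ThetaPartnerAtTwoSignedKatoUpToAtTwoKummerPoint
import HarnessLib

/-!
# Route `ThetaPartnerAtTwo` (TP2), crux K3 `SignedKatoDivisibilityUpToAtTwo` (item stmt-BirchSwinnertonDyer-20308),
# line `colemanrat` v3 — THE POINTS-MODEL POITOU–TATE PAIRING `Hom(A, ℤ_p) × {classes Kummer-from-A} → ℚ/ℤ`,
# `(φ_A, [∂Q]) ↦ φ_A(p^k Q)/p^k`: it EXISTS as a bi-additive map (well defined by `…KummerPoint`), any `K`, `p`, `κ`, `ι` and any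
# `p`-saturated `A ≤ E(K_∞·K_v)`. With `A = ⨆ₙ E^ε(K_n·K_v)` and `Sel^ε(E/K_∞) ≤ Kummer(A)` (K4: `SignedEC.signedSelmerInfty_le_
# localKummerOverOfEmb_iSup_signedLocalPoints`) this is the map `j : P = Hom(E^ε_∞, ℤ_p) → Hom(Sel^ε_∞, ℚ/ℤ) = X^ε` of K3's package
# in Sprung's points model of the local Iwasawa cohomology (the currency of the `bsd-2adic` ♭ Coleman map `SSFlatEC.*` at `p = 2`).

Width seat `bsd-wall-tp2-p2x-w3` g2 (cell `bsd-wall`). HONEST FRAMING: THEOREMS ONLY — no definition, no named fact, no instance,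
no `sorry`; route-independent; closes no item; BSD is NOT proved by any of this. NOT here (next bricks): `Λ`-linearity of `j` for the
`IsLocNil` structures, and the local cover «characters of `Sel^ε` vanishing on `ker res_𝔭` are values of `j`» (needs
`Hom(A ⊗ ℚ_p/ℤ_p, ℚ/ℤ) = Hom(A, ℤ_p)`).

## What is proved

* §1 `val_smul_invPow_add` — additivity of `x ↦ (x mod p^k) • (1/p^k)` on `ℤ_p`.
* §2 `exists_kummerCharacter` — for each `φ_A : A →+ ℤ_p` a CHARACTER `χ` of the group of Kummer-from-`A` classes with
  `χ [∂Q] = (φ_A(p^k Q) mod p^k) • (1/p^k)` for EVERY witness `(Q, k)`; `kummerCharacter_unique`.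
* §3 `exists_kummerPairing` — the characters assemble to an additive `J : (A →+ ℤ_p) →+ (Kummer(A) →+ ℚ/ℤ)` with the same formula
  (bi-additivity of the points-model pairing).

References: [Kobayashi2003] §2 p. 4 (Kummer map), (7.17) (p. 12), (8.23) (p. 18: the pairing `( , )_n`); [Sprung2012] §1 p. 1486;
[SilvermanAEC2009] VIII §2, X §4.
-/

set_option autoImplicit false
-- the Theorems namespace of this sub repeats the summit name by design (D-0017 nested layout)
set_option linter.dupNamespace false

noncomputable section

open scoped Classical

namespace Summit.BirchSwinnertonDyer.BirchSwinnertonDyer.Theorems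

namespace SignedKatoOffTwo.KummerPoint

open NumberField IsDedekindDomain Field WeierstrassCurve
  Literature.NumberTheory.EllipticCurves Literature.NumberTheory.EllipticCurves.Kobayashi2003
  Literature.NumberTheory.EllipticCurves.Sprung2012 Literature.NumberTheory.GaloisRepresentations ZpExtension

universe u

/-! ## §1 Additivity of the value map `x ↦ (x mod p^k) • (1/p^k)` -/

section Values

variable (p : ℕ) [Fact p.Prime]

/-- `((x + y) mod p^k) • (1/p^k) = (x mod p^k) • (1/p^k) + (y mod p^k) • (1/p^k)` in `ℚ/ℤ`. [folklore] -/
theorem val_smul_invPow_add (k : ℕ) (x y : ℤ_[p]) :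
    (PadicInt.toZModPow k (x + y)).val • ((((p : ℚ) ^ k)⁻¹ : ℚ) : AddCircle (1 : ℚ)) =
      (PadicInt.toZModPow k x).val • ((((p : ℚ) ^ k)⁻¹ : ℚ) : AddCircle (1 : ℚ)) +
        (PadicInt.toZModPow k y).val • ((((p : ℚ) ^ k)⁻¹ : ℚ) : AddCircle (1 : ℚ)) := by
  haveI : NeZero (p ^ k) := ⟨pow_ne_zero k (Fact.out : p.Prime).ne_zero⟩
  have hk0 := pow_nsmul_invPow_self p k
  rw [map_add, ← add_smul]
  refine IwasawaDual.smul_eq_of_modEq hk0 ?_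
  rw [ZMod.val_add]
  exact Nat.mod_modEq _ _

/-- The value of `0` is `0`. [folklore] -/
theorem val_smul_invPow_zero (k : ℕ) :
    (PadicInt.toZModPow k (0 : ℤ_[p])).val • ((((p : ℚ) ^ k)⁻¹ : ℚ) : AddCircle (1 : ℚ)) = 0 := by
  rw [map_zero, ZMod.val_zero, zero_smul]

end Values

/-! ## §2 The character of the Kummer-from-`A` classes attached to a functional `φ_A : A → ℤ_p` -/

section Character

variable {K : Type u} [Field K] (W : WeierstrassCurve K) (p : ℕ) [Fact p.Prime] (κ : ZpExtension K p)
  {E : Type u} [Field E] [Algebra K E] (ι : AlgebraicClosure K →ₐ[K] AlgebraicClosure E)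

/-- **The character `χ_{φ_A}` of the Kummer-from-`A` classes.** For `A ≤ E(K_∞·K_v)` `p`-saturated in the tower and `φ_A : A →+ ℤ_p`
there is an additive `χ : Kummer(A) →+ ℚ/ℤ` (`Kummer(A) = localKummerOverOfEmb W p (ker κ) ι A ≤ H¹(K_∞, E[p^∞])`) with
`χ c = (φ_A(p^k Q) mod p^k) • (1/p^k)` for EVERY Kummer witness `(φ, Q, k)` of `c` — the points-model Tate pairing of `c` with the
local class `φ_A` (Kobayashi's `(x, z)_n` read through `E(k_n) ⊗ ℚ_p/ℤ_p ↪ H¹(k_n, E[p^∞])`). Well defined by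
`kummerValue_eq_of_kummerReps`; additive because the sum of witnesses is a witness of the sum.
[cite: Kobayashi2003, §2 p. 4 and (8.23) (p. 18)] [cite: Sprung2012, §1 p. 1486] -/
theorem exists_kummerCharacter (A : AddSubgroup (localPoints W E))
    (hsat : ∀ y ∈ localTowerPointsOfEmb κ ι W, p • y ∈ A → y ∈ A) (φA : A →+ ℤ_[p]) :
    ∃ χ : localKummerOverOfEmb W p κ.kerSubgroup ι A →+ AddCircle (1 : ℚ),
      ∀ (c : localKummerOverOfEmb W p κ.kerSubgroup ι A)
        (φ : contOneCocycles (discreteTopRep κ.kerSubgroup (W.geomPrimaryTorsion p))) (Q : localPoints W E) (k : ℕ)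
        (_ : oneCocycleClass _ φ = (c : W.subgroupH1 p κ.kerSubgroup)) (hQ : p ^ k • Q ∈ A)
        (_ : ∀ τ : localSubgroupOfEmb κ.kerSubgroup ι,
          pointsMapOfEmb W ι ((φ.1 (resGalSubgroupOfEmb κ.kerSubgroup ι τ) : W.geomPrimaryTorsion p) : W.geomPoints) =
            (τ : Field.absoluteGaloisGroup E) • Q - Q),
        χ c = (PadicInt.toZModPow k (φA ⟨p ^ k • Q, hQ⟩)).val • ((((p : ℚ) ^ k)⁻¹ : ℚ) : AddCircle (1 : ℚ)) := by
  -- chosen witnesses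
  have hex : ∀ c : localKummerOverOfEmb W p κ.kerSubgroup ι A,
      ∃ (φ : contOneCocycles (discreteTopRep κ.kerSubgroup (W.geomPrimaryTorsion p))) (Q : localPoints W E) (k : ℕ),
        oneCocycleClass _ φ = (c : W.subgroupH1 p κ.kerSubgroup) ∧ p ^ k • Q ∈ A ∧
        ∀ τ : localSubgroupOfEmb κ.kerSubgroup ι,
          pointsMapOfEmb W ι ((φ.1 (resGalSubgroupOfEmb κ.kerSubgroup ι τ) : W.geomPrimaryTorsion p) : W.geomPoints) =
            (τ : Field.absoluteGaloisGroup E) • Q - Q :=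
    fun c ↦ (mem_localKummerOverOfEmb_iff A (c : W.subgroupH1 p κ.kerSubgroup)).1 c.2
  choose φ Q k hφ hQ hτ using hex
  -- the value function and its independence of the witness
  set v : localKummerOverOfEmb W p κ.kerSubgroup ι A → AddCircle (1 : ℚ) := fun c ↦
    (PadicInt.toZModPow (k c) (φA ⟨p ^ k c • Q c, hQ c⟩)).val • ((((p : ℚ) ^ k c)⁻¹ : ℚ) : AddCircle (1 : ℚ)) with hv
  have hwd : ∀ (c : localKummerOverOfEmb W p κ.kerSubgroup ι A)
      (φ' : contOneCocycles (discreteTopRep κ.kerSubgroup (W.geomPrimaryTorsion p))) (Q' : localPoints W E) (k' : ℕ)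
      (_ : oneCocycleClass _ φ' = (c : W.subgroupH1 p κ.kerSubgroup)) (hQ' : p ^ k' • Q' ∈ A)
      (_ : ∀ τ : localSubgroupOfEmb κ.kerSubgroup ι,
        pointsMapOfEmb W ι ((φ'.1 (resGalSubgroupOfEmb κ.kerSubgroup ι τ) : W.geomPrimaryTorsion p) : W.geomPoints) =
          (τ : Field.absoluteGaloisGroup E) • Q' - Q'),
      v c = (PadicInt.toZModPow k' (φA ⟨p ^ k' • Q', hQ'⟩)).val • ((((p : ℚ) ^ k')⁻¹ : ℚ) : AddCircle (1 : ℚ)) :=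
    fun c φ' Q' k' hφ' hQ' hτ' ↦
      kummerValue_eq_of_kummerReps W p κ ι A hsat φA ((hφ c).trans hφ'.symm) (hQ c) hQ' (hτ c) hτ'
  refine ⟨{ toFun := v, map_zero' := ?_, map_add' := fun c₁ c₂ ↦ ?_ }, fun c φ' Q' k' hφ' hQ' hτ' ↦ hwd c φ' Q' k' hφ' hQ' hτ'⟩
  · -- witness `(0, 0, 1)` of the zero class
    have h0A : p ^ 1 • (0 : localPoints W E) ∈ A := by rw [smul_zero]; exact zero_mem A
    rw [hwd 0 0 0 1 (by rw [oneCocycleClass_zero]; rfl) h0A (fun τ ↦ by simp)]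
    have : (⟨p ^ 1 • (0 : localPoints W E), h0A⟩ : A) = 0 := Subtype.ext (smul_zero _)
    rw [this, map_zero, val_smul_invPow_zero]
  · -- the sum of the chosen witnesses is a witness of the sum
    set K₀ := k c₁ + k c₂ with hK₀
    have hQ₁K : p ^ K₀ • Q c₁ ∈ A := by
      rw [hK₀, pow_add, mul_comm, mul_smul]; exact AddSubgroup.nsmul_mem _ (hQ c₁) _
    have hQ₂K : p ^ K₀ • Q c₂ ∈ A := by
      rw [hK₀, pow_add, mul_smul]; exact AddSubgroup.nsmul_mem _ (hQ c₂) _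
    have hsumA : p ^ K₀ • (Q c₁ + Q c₂) ∈ A := by rw [smul_add]; exact add_mem hQ₁K hQ₂K
    have hclass : oneCocycleClass _ (φ c₁ + φ c₂) = ((c₁ + c₂ : localKummerOverOfEmb W p κ.kerSubgroup ι A) :
        W.subgroupH1 p κ.kerSubgroup) := by
      rw [oneCocycleClass_add, hφ, hφ]; rfl
    have hτsum : ∀ τ : localSubgroupOfEmb κ.kerSubgroup ι,
        pointsMapOfEmb W ι (((φ c₁ + φ c₂).1 (resGalSubgroupOfEmb κ.kerSubgroup ι τ) : W.geomPrimaryTorsion p) :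
          W.geomPoints) = (τ : Field.absoluteGaloisGroup E) • (Q c₁ + Q c₂) - (Q c₁ + Q c₂) := by
      intro τ
      rw [Submodule.coe_add, ContinuousMap.add_apply, AddSubgroup.coe_add, map_add, hτ c₁ τ, hτ c₂ τ, smul_add]
      abel
    show v (c₁ + c₂) = v c₁ + v c₂
    rw [hwd (c₁ + c₂) (φ c₁ + φ c₂) (Q c₁ + Q c₂) K₀ hclass hsumA hτsum,
      hwd c₁ (φ c₁) (Q c₁) K₀ (hφ c₁) hQ₁K (hτ c₁), hwd c₂ (φ c₂) (Q c₂) K₀ (hφ c₂) hQ₂K (hτ c₂)]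
    have e : (⟨p ^ K₀ • (Q c₁ + Q c₂), hsumA⟩ : A) = ⟨p ^ K₀ • Q c₁, hQ₁K⟩ + ⟨p ^ K₀ • Q c₂, hQ₂K⟩ :=
      Subtype.ext (smul_add _ _ _)
    rw [e, map_add, val_smul_invPow_add]

/-- **Uniqueness**: a character of `Kummer(A)` is determined by the value formula (every class has a witness). [folklore] -/
theorem kummerCharacter_unique (A : AddSubgroup (localPoints W E)) (φA : A →+ ℤ_[p])
    (χ χ' : localKummerOverOfEmb W p κ.kerSubgroup ι A →+ AddCircle (1 : ℚ))
    (hχ : ∀ (c : localKummerOverOfEmb W p κ.kerSubgroup ι A)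
      (φ : contOneCocycles (discreteTopRep κ.kerSubgroup (W.geomPrimaryTorsion p))) (Q : localPoints W E) (k : ℕ)
      (_ : oneCocycleClass _ φ = (c : W.subgroupH1 p κ.kerSubgroup)) (hQ : p ^ k • Q ∈ A)
      (_ : ∀ τ : localSubgroupOfEmb κ.kerSubgroup ι,
        pointsMapOfEmb W ι ((φ.1 (resGalSubgroupOfEmb κ.kerSubgroup ι τ) : W.geomPrimaryTorsion p) : W.geomPoints) =
          (τ : Field.absoluteGaloisGroup E) • Q - Q),
      χ c = (PadicInt.toZModPow k (φA ⟨p ^ k • Q, hQ⟩)).val • ((((p : ℚ) ^ k)⁻¹ : ℚ) : AddCircle (1 : ℚ)))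
    (hχ' : ∀ (c : localKummerOverOfEmb W p κ.kerSubgroup ι A)
      (φ : contOneCocycles (discreteTopRep κ.kerSubgroup (W.geomPrimaryTorsion p))) (Q : localPoints W E) (k : ℕ)
      (_ : oneCocycleClass _ φ = (c : W.subgroupH1 p κ.kerSubgroup)) (hQ : p ^ k • Q ∈ A)
      (_ : ∀ τ : localSubgroupOfEmb κ.kerSubgroup ι,
        pointsMapOfEmb W ι ((φ.1 (resGalSubgroupOfEmb κ.kerSubgroup ι τ) : W.geomPrimaryTorsion p) : W.geomPoints) =
          (τ : Field.absoluteGaloisGroup E) • Q - Q),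
      χ' c = (PadicInt.toZModPow k (φA ⟨p ^ k • Q, hQ⟩)).val • ((((p : ℚ) ^ k)⁻¹ : ℚ) : AddCircle (1 : ℚ))) :
    χ = χ' := by
  ext c
  obtain ⟨φ, Q, k, hφ, hQ, hτ⟩ := (mem_localKummerOverOfEmb_iff A (c : W.subgroupH1 p κ.kerSubgroup)).1 c.2
  rw [hχ c φ Q k hφ hQ hτ, hχ' c φ Q k hφ hQ hτ]

/-! ## §3 Bi-additivity: the pairing `Hom(A, ℤ_p) →+ Hom(Kummer(A), ℚ/ℤ)` -/

/-- **The points-model Poitou–Tate pairing is bi-additive**: there is an additive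
`J : (A →+ ℤ_p) →+ (Kummer(A) →+ ℚ/ℤ)` with `J φ_A c = (φ_A(p^k Q) mod p^k) • (1/p^k)` for every witness `(Q, k)` of `c` — with
`A = ⨆ₙ E^ε(K_n·K_v)` and `Sel^ε(E/K_∞) ≤ Kummer(A)` this is (the additive map underlying) `j : Hom(E^ε_∞, ℤ_p) → X^ε(E/K_∞)` of K3's
`2`-robust package in the points model. [cite: Kobayashi2003, (7.17) (p. 12), (8.23) (p. 18)] [cite: Sprung2012, §1 p. 1486] -/
theorem exists_kummerPairing (A : AddSubgroup (localPoints W E))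
    (hsat : ∀ y ∈ localTowerPointsOfEmb κ ι W, p • y ∈ A → y ∈ A) :
    ∃ J : (A →+ ℤ_[p]) →+ (localKummerOverOfEmb W p κ.kerSubgroup ι A →+ AddCircle (1 : ℚ)),
      ∀ (φA : A →+ ℤ_[p]) (c : localKummerOverOfEmb W p κ.kerSubgroup ι A)
        (φ : contOneCocycles (discreteTopRep κ.kerSubgroup (W.geomPrimaryTorsion p))) (Q : localPoints W E) (k : ℕ)
        (_ : oneCocycleClass _ φ = (c : W.subgroupH1 p κ.kerSubgroup)) (hQ : p ^ k • Q ∈ A)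
        (_ : ∀ τ : localSubgroupOfEmb κ.kerSubgroup ι,
          pointsMapOfEmb W ι ((φ.1 (resGalSubgroupOfEmb κ.kerSubgroup ι τ) : W.geomPrimaryTorsion p) : W.geomPoints) =
            (τ : Field.absoluteGaloisGroup E) • Q - Q),
        J φA c = (PadicInt.toZModPow k (φA ⟨p ^ k • Q, hQ⟩)).val • ((((p : ℚ) ^ k)⁻¹ : ℚ) : AddCircle (1 : ℚ)) := by
  choose χ hχ using fun φA : A →+ ℤ_[p] ↦ exists_kummerCharacter W p κ ι A hsat φA
  refine ⟨{ toFun := χ, map_zero' := ?_, map_add' := fun φA ψA ↦ ?_ }, fun φA c φ' Q k hφ' hQ hτ ↦ hχ φA c φ' Q k hφ' hQ hτ⟩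
  · ext c
    obtain ⟨φ', Q, k, hφ', hQ, hτ⟩ := (mem_localKummerOverOfEmb_iff A (c : W.subgroupH1 p κ.kerSubgroup)).1 c.2
    rw [hχ 0 c φ' Q k hφ' hQ hτ, AddMonoidHom.zero_apply, AddMonoidHom.zero_apply, val_smul_invPow_zero]
  · ext c
    obtain ⟨φ', Q, k, hφ', hQ, hτ⟩ := (mem_localKummerOverOfEmb_iff A (c : W.subgroupH1 p κ.kerSubgroup)).1 c.2
    rw [AddMonoidHom.add_apply (χ φA) (χ ψA) c, hχ (φA + ψA) c φ' Q k hφ' hQ hτ, hχ φA c φ' Q k hφ' hQ hτ,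
      hχ ψA c φ' Q k hφ' hQ hτ, AddMonoidHom.add_apply, val_smul_invPow_add]

end Character

end SignedKatoOffTwo.KummerPoint

end Summit.BirchSwinnertonDyer.BirchSwinnertonDyer.Theorems

end
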